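import Literature.NumberTheory.EllipticCurves.HeegnerTraceRelationLevelDividingProofs
import Literature.NumberTheory.EllipticCurves.HeegnerGeomBottomRelationProofs
import Literature.NumberTheory.EllipticCurves.HeegnerNormPointExistenceAnyConductorProofs
import HarnessLib

/-!
# The norm relation at a prime DIVIDING THE LEVEL, split step `p ∤ m`:
# `Tr_{K[pm]/K[m]} y(pm) = a_p · y(m) − y'(m)` for `p ∣ N`, `p ∤ m` (`y'(m)` one conjugate of `y(m)`),
# and the BOTTOM of the canonical Heegner family at `p ∣ N`: `z_0 = (a_p − 1) · y_K`

Topic `NumberTheory/EllipticCurves` (complex multiplication / Heegner points; sequel of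
`HeegnerTraceRelationLevelDividingProofs` (`p ∣ N`, `p ∣ m`), `HeegnerTraceRelationSplitProofs` (`p ∤ N` split)
and `HeegnerGeomBottomRelationProofs` (the bottom relation in `E(K̄)` at `p ∤ N`)), namespace
`Literature.NumberTheory.EllipticCurves` (helpers under `HeegnerTraceLevelDividingSplit`). THEOREMS ONLY: no
definition, no named fact (D-0026); net Literature debt `0`.

## The statements

`E = W/ℚ` with a parametrisation datum `Dt` at level `N`, `K` imaginary quadratic, `β` an orientation
(`4N ∣ β² − d_K`), `x(k)`, `y(k) = φ(x(k))` Gross's principal Heegner points; `p ≥ 3` a prime with `p ∣ N`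
that SPLITS in `K` (as it does under the Heegner hypothesis), `p ∤ m`, `m ≥ 1` (and `m ≥ 2 ∨ d_K < −4`, so that
`𝒪_m^× = 𝒪_{pm}^× = {±1}`; then `[K[pm] : K[m]] = p − 1`):

* `exists_map_sum_pointGalHom_eq_lFunction_smul_sub` — for any finset `G` enumerating `Gal(K[pm]/K[m])` and any
  `y ∈ E(K[pm])` over `y(pm)`: **`(∑_{g ∈ G} g • y)_ℂ = a_p(W) • y(m)_ℂ − φ(τ_{Q'})`** for a level-`N` Heegner
  form `Q'` of conductor `m` and residue `mβ` (the ONE `𝒪_m`-stable point of the divisor `U_p(x(m))`; the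
  other `p − 1` points of `U_p(x(m)) = {(x(m) + i)/p}` are the `K[m]`-conjugates of `x(pm) = x(m)/p`; the second
  `𝒪_m`-stable `p`-neighbour `p · x(m)` is NOT in `U_p(x(m))` — this is where `p ∣ N` differs from Darmon's split
  case `Tr = (a_p − σ_λ − σ_λ⁻¹) P_n` at `p ∤ N`); `…_of_eq` / `exists_finsum_…` the `n = p * m` / `∑ᶠ` forms.
* `sum_transversal_smul_eq_lFunction_smul_sub_of_dvd_level` (in `E(K̄)`, conductor `p` over conductor `1`): for
  `x₁, x_p ∈ E(K̄)` over `y(1)`, `y(p)` and any transversal `R` of `Gal(K̄/K[p])` in `Gal(K̄/K[1])`,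
  `∑_{r ∈ R} r • x_p = a_p • x₁ − x'` with `x'` a Heegner point of conductor `1` and orientation `β`
  (`IsHeegnerGeomPoint N W K Dt β 1 jbar x'`).
* **`z_zero_eq_sub_smul_y`** — for a Heegner family `F` whose bottom points are the canonical ones (the shape of
  `exists_heegnerFamily_canonical`: `y = Norm_{K[1]/K} x₁`, `z_0 = Norm_{K[p]/K} x_p`), under the Heegner
  hypothesis and `d_K < −4`: **`z_0 = a_p(W) • y − y`** (Shimura reciprocity at conductor `1`:
  `Norm_{K[1]/K} x' = Norm_{K[1]/K} x₁ = y`, `HeegnerGeomBottomRelationProofs.sum_smul_eq_sum_smul_of_isHeegnerGeomPoint_one`);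
  `exists_heegnerFamily_z_zero_eq` packages it with `exists_heegnerFamily_canonical`. When `a_p(W) = 0` (additive
  `p`): `z_0 = −y` — the bottom norm point of the canonical family IS `−y_K`, so it is non-torsion exactly when
  `y_K` is (Gross–Zagier), with no appeal to Cornut–Vatsal at the bottom layer (`exists_heegnerFamily_z_zero_eq_neg`).

No tower hypothesis is needed here (`K_0 = K`).

## Proof

The transport `exists_levelTransport_tpB_of_fix_ringClassField_of_kleinJ` (§6 of
`HeegnerTraceRelationLevelDividingProofs`) with the split-case `j`-facts (`j(x(pm)) ∉ K[m]`:
`HeegnerTraceSplit.kleinJ_heegnerPointOfConductor_mul_not_mem_ringClassField_of_split`; `j(p·x(m)) ∈ K[m]`: `p·x(m)`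
is the root of the primitive form `(A/p, B, p)` of discriminant `m²d_K`, §1); the OLD index `k₀` (root of
`−Bk + 1 ≡ 0 (mod p)`, `p ∣ A`; `HeegnerTraceSplit.exists_root_of_dvd`, `tpB_smul_heegnerTau_of_dvd`,
`mem_heegnerForms_tpB_of_dvd`) whose point has `j ∈ K[m]` and is therefore avoided by the conjugates; injectivity
(generator theorem) and counting `#Gal(K[pm]/K[m]) = p − 1` (`HeegnerTraceSplit.card_ringClassGalOver_eq_of_split`);
Eichler–Shimura `a_p • φ(τ) = ∑_{i<p} φ((τ + i)/p)` at `p ∣ N` (`lFunction_zsmul_φ`). The `E(K̄)` forms follow by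
the `jbar`-dictionary (`exists_finset_ringClassGalOver_complexPoint_sum_smul_eq`, `complexPoint_injective`) and the
transversal calculus (`sum_smul_eq_sum_sum_smul`).

## References

* [CornutVatsal2007] §6.2–6.4 (distribution relations of `δ`-lattices; the good CM points of conductor `P`).
* [Darmon2004] §3.4 Prop. 3.10 (split case) and its proof (p. 36, (3.10)–(3.11)); Thm. 3.7.
* [GrossLMS1991] §3 Prop. 3.7; [Gross1984] §I.1; [PerrinRiou1987BSMF] §3.3.
* [Knapp1993] Thm. 11.74 (b) (`T_p = U_p` for `p ∣ N`).
-/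

set_option autoImplicit false

noncomputable section

open scoped Classical MatrixGroups
open Complex UpperHalfPlane CongruenceSubgroup NumberField Module PeriodPair
open Literature.NumberTheory.EllipticCurves.RingClassField
open Literature.NumberTheory.EllipticCurves.ModularForms

namespace Literature.NumberTheory.EllipticCurves

namespace HeegnerTraceLevelDividingSplit

open Literature.NumberTheory.EllipticCurves.HeegnerTraceDividing
open Literature.NumberTheory.EllipticCurves.HeegnerTraceSplit
open Literature.NumberTheory.EllipticCurves.HeegnerTraceLevelDividing

variable {K : Type} [Field K] [NumberField K]

/-! ## §1 Arithmetic at a split prime `p ∣ N`, `p ∤ m`: `p ∣ A`, `p ∤ B`, the old index, `j(p·x(m)) ∈ K[m]` -/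

/-- `p ∤ m² d_K` for a prime `p ∤ m` split in `K` (copy of the private helper of
`HeegnerTraceRelationSplitProofs`). [folklore] -/
private theorem not_dvd_sq_mul_discr_of_split (hK : IsImaginaryQuadratic K) {p m : ℕ} (hp : p.Prime)
    (hsplit : ((Ideal.span {(p : ℤ)}).primesOver (𝓞 K)).ncard = 2) (hpm : ¬ p ∣ m) :
    ¬ (p : ℤ) ∣ (m : ℤ) ^ 2 * NumberField.discr K := by
  have hpprime : Prime (p : ℤ) := Nat.prime_iff_prime_int.mp hp
  have hpm' : ¬ (p : ℤ) ∣ (m : ℤ) ^ 2 := fun h => hpm (by exact_mod_cast hpprime.dvd_of_dvd_pow h)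
  intro h
  rcases hpprime.dvd_or_dvd h with h1 | h1
  · exact hpm' h1
  · by_cases hp2 : p = 2
    · subst hp2
      have h8 := discr_emod_eight_of_split_two hK.1 hsplit
      omega
    · exact (exists_sq_sub_discr_dvd_of_split hK.1 hp hp2 hsplit).1 h1

/-- For `p ∣ N` and `4N ∣ β² − D`: `p` divides the leading coefficient `m²(β² − D)/4` of the form of
conductor `m`. [folklore] -/
private theorem natCast_dvd_fst {N : ℕ} {D β : ℤ} (hβ : (4 * N : ℤ) ∣ β ^ 2 - D) {p : ℕ}
    (hpN : p ∣ N) (m : ℕ) : (p : ℤ) ∣ (m : ℤ) ^ 2 * ((β ^ 2 - D) / 4) := by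
  obtain ⟨t, ht⟩ := hβ
  have h4 : (β ^ 2 - D) / 4 = (N : ℤ) * t := by
    rw [ht, show (4 : ℤ) * N * t = 4 * (N * t) by ring, Int.mul_ediv_cancel_left _ four_ne_zero]
  rw [h4]
  exact dvd_mul_of_dvd_right (dvd_mul_of_dvd_left (Int.natCast_dvd_natCast.mpr hpN) _) _

/-- **The OLD point of `U_p(x(m))` at `p ∣ N`, `p ∤ m` (split `p`).** With `x(m) = τ_{(A, B, 1)}`,
`A = m²(β² − d_K)/4` (so `p ∣ A`), `B = mβ` (`p ∤ B`): for the root `k₀` of `−Bk + 1 ≡ 0 (mod p)`, the point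
`(x(m) + k₀)/p` is `τ_{Q'}` for a level-`N` Heegner form `Q' = (Ap, B − 2Ak₀, C')` of discriminant `m²d_K` and
residue `mβ` — a Heegner point of the SAME conductor `m` (Darmon's `P⁽⁰⁾`, the sublattice attached to `A[λ]`).
[cite: Darmon2004, Prop. 3.10 (proof, p. 36, eq. (3.10))] [cite: Gross1984, §I.1] -/
theorem exists_old_index (hK : IsImaginaryQuadratic K) {N : ℕ} [NeZero N] {β : ℤ}
    (hβ : (4 * N : ℤ) ∣ β ^ 2 - NumberField.discr K) {p m : ℕ} (hp : p.Prime) (hpN : p ∣ N)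
    (hsplit : ((Ideal.span {(p : ℤ)}).primesOver (𝓞 K)).ncard = 2) (hpm : ¬ p ∣ m) (hm : m ≠ 0)
    [NeZero p] :
    ∃ (k₀ : Fin p) (Q : ℤ × ℤ × ℤ), Q ∈ heegnerForms N ((m : ℤ) ^ 2 * NumberField.discr K) ∧
      Q.2.1 ≡ (m : ℤ) * β [ZMOD 2 * N] ∧
      tpB p ((k₀ : ℕ) : ℤ) • heegnerPointOfConductor (NumberField.discr K) β m = heegnerTau Q := by
  set D : ℤ := NumberField.discr K with hDdef
  have hD : D < 0 := hK.discr_neg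
  obtain ⟨hQ, hres⟩ := heegnerFormOfConductor_mem_heegnerForms (N := N) hD hβ hm
  set A : ℤ := (m : ℤ) ^ 2 * ((β ^ 2 - D) / 4) with hAdef
  set B : ℤ := (m : ℤ) * β with hBdef
  have hQ0 : heegnerFormOfConductor D β m = (A, B, 1) := rfl
  rw [hQ0] at hQ hres
  have hx : heegnerPointOfConductor D β m = heegnerTau (A, B, 1) := by
    rw [heegnerPointOfConductor, hQ0]
  obtain ⟨hdisc, hApos, hNA, hprim⟩ := hQ
  simp only at hdisc hApos hNA hprim hres
  have hQ' : (A, B, (1 : ℤ)) ∈ heegnerForms N ((m : ℤ) ^ 2 * D) := ⟨hdisc, hApos, hNA, hprim⟩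
  have hdisc' : B ^ 2 - 4 * A * 1 < 0 := by
    rw [hdisc]; exact mul_neg_of_pos_of_neg (pow_pos (by exact_mod_cast Nat.pos_of_ne_zero hm) 2) hD
  have hpD : ¬ (p : ℤ) ∣ (m : ℤ) ^ 2 * D := not_dvd_sq_mul_discr_of_split hK hp hsplit hpm
  have hpA : (p : ℤ) ∣ A := natCast_dvd_fst hβ hpN m
  have hpB : ¬ (p : ℤ) ∣ B := by
    intro h
    apply hpD
    rw [← hdisc]
    exact dvd_sub (dvd_pow h two_ne_zero) (dvd_mul_of_dvd_left (dvd_mul_of_dvd_right hpA _) _)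
  obtain ⟨k₀, hk₀⟩ := exists_root_of_dvd (C := 1) hp hpA hpB
  obtain ⟨C', hC'⟩ := hk₀
  refine ⟨k₀, (A * p, B - 2 * A * ((k₀ : ℕ) : ℤ), C'), (mem_heegnerForms_tpB_of_dvd hQ' hp hpD hC'.symm).1,
    ((mem_heegnerForms_tpB_of_dvd hQ' hp hpD hC'.symm).2).trans hres, ?_⟩
  rw [hx]
  exact tpB_smul_heegnerTau_of_dvd hApos hdisc' hC'.symm

/-- **`j(p · x(m)) ∈ K[m]` at `p ∣ N`, `p ∤ m` (split `p`)**: `p · x(m) = τ_{(A/p, B, p)}` for the PRIMITIVE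
positive definite form `(A/p, B, p)` of discriminant `m²d_K` (`p ∤ B`), a singular modulus of conductor `m`
(Cox Thm. 11.1). (The second `𝒪_m`-stable `p`-neighbour of `x(m)`; at `p ∣ N` it is not a point of `U_p(x(m))`.)
[cite: Cox2013, §11.A Thm. 11.1] [cite: Darmon2004, Prop. 3.10 (proof, p. 36)] -/
theorem kleinJ_tpD_smul_mem_ringClassField_of_dvd_level (hK : IsImaginaryQuadratic K) (ι : K →+* ℂ)
    {N : ℕ} [NeZero N] {β : ℤ} (hβ : (4 * N : ℤ) ∣ β ^ 2 - NumberField.discr K) {p m : ℕ} (hp : p.Prime)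
    (hpN : p ∣ N) (hsplit : ((Ideal.span {(p : ℤ)}).primesOver (𝓞 K)).ncard = 2) (hpm : ¬ p ∣ m)
    (hm : m ≠ 0) [NeZero p] :
    kleinJ (tpD p • heegnerPointOfConductor (NumberField.discr K) β m) ∈ ringClassField K ι m := by
  set D : ℤ := NumberField.discr K with hDdef
  have hD : D < 0 := hK.discr_neg
  obtain ⟨hQ, -⟩ := heegnerFormOfConductor_mem_heegnerForms (N := N) hD hβ hm
  set A : ℤ := (m : ℤ) ^ 2 * ((β ^ 2 - D) / 4) with hAdef
  set B : ℤ := (m : ℤ) * β with hBdef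
  have hQ0 : heegnerFormOfConductor D β m = (A, B, 1) := rfl
  rw [hQ0] at hQ
  have hx : heegnerPointOfConductor D β m = heegnerTau (A, B, 1) := by
    rw [heegnerPointOfConductor, hQ0]
  obtain ⟨hdisc, hApos, -, hprim⟩ := hQ
  simp only at hdisc hApos hprim
  have hpD : ¬ (p : ℤ) ∣ (m : ℤ) ^ 2 * D := not_dvd_sq_mul_discr_of_split hK hp hsplit hpm
  have hpA : (p : ℤ) ∣ A := natCast_dvd_fst hβ hpN m
  have hpB : ¬ (p : ℤ) ∣ B := by
    intro h
    apply hpD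
    rw [← hdisc]
    exact dvd_sub (dvd_pow h two_ne_zero) (dvd_mul_of_dvd_left (dvd_mul_of_dvd_right hpA _) _)
  obtain ⟨A', hA'⟩ := hpA
  have hppos : (0 : ℤ) < p := by exact_mod_cast hp.pos
  have hA'pos : 0 < A' := by
    rw [hA'] at hApos; exact pos_of_mul_pos_right hApos hppos.le
  have hdisc' : B ^ 2 - 4 * ((p : ℤ) * A') * 1 < 0 := by
    rw [← hA', hdisc]; exact mul_neg_of_pos_of_neg (pow_pos (by exact_mod_cast Nat.pos_of_ne_zero hm) 2) hD
  -- `(A', B, p)` is a primitive form of discriminant `m²d_K`, i.e. a level-one Heegner form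
  have hQ1 : ((p : ℤ) * A', B, (1 : ℤ)) ∈ heegnerForms 1 ((m : ℤ) ^ 2 * D) := by
    refine ⟨by simp only; rw [← hA', hdisc], by simpa only [← hA'] using hApos, ?_, ?_⟩
    · simp only [Nat.cast_one]; exact one_dvd _
    · simp only; intro d hdA hdB hdC; exact isUnit_of_dvd_one hdC
  have hQ'' := mem_heegnerForms_tpD_of_dvd (N := 1) hp hQ1 hpD hp.not_dvd_one
  rw [hx, hA', tpD_smul_heegnerTau_of_dvd hA'pos hdisc']
  exact kleinJ_mem_ringClassField_of_mem_heegnerForms hK ι hm hQ''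

/-! ## §2 `φ` along level transport; restriction to `K[n]` (copies of private helpers) -/

/-- **`σ ⋆ φ(τ) = φ(τ')` whenever `LevelTransport N σ τ τ'`** (copy of the private helper of
`HeegnerTraceRelationDividingProofs`). [cite: ShimuraIATAF1971, Thm. 7.14] [cite: Darmon2004, Thm. 3.6 (proof)] -/
private theorem map_φ_of_levelTransport {W : WeierstrassCurve ℚ} {N : ℕ} [NeZero N]
    (Dt : ModularParametrizationData W N) {σ : ℂ ≃+* ℂ} {τ τ' : ℍ}
    (hT : LevelTransport N σ τ τ') :
    WeierstrassCurve.Affine.Point.map (σ : ℂ →+* ℂ).toRatAlgHom (Dt.φ τ) = Dt.φ τ' := by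
  obtain ⟨hiff, hval⟩ := Dt.transport_weierstrassP_values σ hT
  set z : ℂ := (Dt.c : ℂ) * eichlerIntegral Dt.f τ with hz_def
  set z' : ℂ := (Dt.c : ℂ) * eichlerIntegral Dt.f τ' with hz'_def
  change WeierstrassCurve.Affine.Point.map _ (Dt.uniformize z) = Dt.uniformize z'
  by_cases hz : z ∈ Dt.L.lattice
  · rw [(Dt.uniformize_eq_zero_iff z).mpr hz, (Dt.uniformize_eq_zero_iff z').mpr (hiff.mp hz),
      map_zero]
  · have hz' : z' ∉ Dt.L.lattice := fun h' => hz (hiff.mpr h')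
    obtain ⟨h₁, h₂⟩ := hval hz
    obtain ⟨hn, hspec⟩ := Dt.uniformize_spec z hz
    obtain ⟨hn', hspec'⟩ := Dt.uniformize_spec z' hz'
    have hσq : ∀ q : ℚ, σ (algebraMap ℚ ℂ q) = algebraMap ℚ ℂ q := fun q => by
      rw [eq_ratCast, map_ratCast]
    rw [hspec, hspec', WeierstrassCurve.Affine.Point.map_some,
      WeierstrassCurve.Affine.Point.some.injEq]
    refine ⟨?_, ?_⟩
    · simp only [RingHom.toRatAlgHom_apply, RingEquiv.coe_toRingHom, WeierstrassCurve.baseChange,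
        WeierstrassCurve.map_b₂, map_sub, map_div₀, map_ofNat, hσq, h₁]
    · simp only [RingHom.toRatAlgHom_apply, RingEquiv.coe_toRingHom, WeierstrassCurve.baseChange,
        WeierstrassCurve.map_b₂, WeierstrassCurve.map_a₁, WeierstrassCurve.map_a₃, map_sub,
        map_div₀, map_mul, map_ofNat, hσq, h₁, h₂]

/-- **`(g • P)_ℂ = σ ⋆ P_ℂ`** when `σ` restricts to `g` on `K[n]` (copy of the private helper of
`HeegnerTraceRelationDividingProofs`). [folklore] -/
private theorem map_subtype_pointGalHom_eq {W : WeierstrassCurve ℚ} (ι : K →+* ℂ) {n : ℕ}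
    (g : ringClassField K ι n ≃ₐ[ℚ] ringClassField K ι n) {σ : ℂ ≃+* ℂ}
    (hσ : ∀ x : ringClassField K ι n, σ x = ((g x : ringClassField K ι n) : ℂ))
    (P : (W.baseChange (ringClassField K ι n)).toAffine.Point) :
    WeierstrassCurve.Affine.Point.map (W' := W) (ringClassField K ι n).subtype.toRatAlgHom
        (pointGalHom W (ringClassField K ι n) g P) =
      WeierstrassCurve.Affine.Point.map (W' := W) (σ : ℂ →+* ℂ).toRatAlgHom
        (WeierstrassCurve.Affine.Point.map (W' := W) (ringClassField K ι n).subtype.toRatAlgHom P) := by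
  have h : (ringClassField K ι n).subtype.toRatAlgHom.comp
      (g : ringClassField K ι n →ₐ[ℚ] ringClassField K ι n) =
      (σ : ℂ →+* ℂ).toRatAlgHom.comp (ringClassField K ι n).subtype.toRatAlgHom :=
    AlgHom.ext fun x => (hσ x).symm
  rw [pointGalHom_apply, WeierstrassCurve.Affine.Point.map_map,
    WeierstrassCurve.Affine.Point.map_map, h]

/-- An automorphism of `ℂ` fixing `K[m]` pointwise fixes `ι(K) ⊆ K[m]`. [folklore] -/
private theorem apply_eq_of_forall_mem_ringClassField (ι : K →+* ℂ) {m : ℕ} {σ : ℂ ≃+* ℂ}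
    (hσ : ∀ x ∈ ringClassField K ι m, σ x = x) (k : K) : σ (ι k) = ι k :=
  hσ (ι k) (by
    rw [← coe_algebraMap_ringClassField ι m k]
    exact (algebraMap K (ringClassField K ι m) k).2)

/-! ## §3 The adapter at `p ∣ N`, `p ∤ m` (split): `Gal(K[pm]/K[m]) ↪ Fin p` onto the complement of the old index -/

/-- **The `G_p` adapter at a split prime `p ∣ N`, `p ∤ m`, `p ≥ 3`.** For `K` imaginary quadratic,
`4N ∣ β² − d_K`, `m ≥ 1` with `m ≥ 2 ∨ d_K < −4`, and an index `k₀` whose point `(x(m) + k₀)/p` has `j`-invariant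
in `K[m]` (the OLD index of `exists_old_index`): there are extensions `σ_g ∈ Aut(ℂ/K[m])` of the
`g ∈ G_p = Gal(K[pm]/K[m])` and an INJECTIVE map `i : G_p → Fin p` AVOIDING `k₀` with
`LevelTransport N σ_g x(pm) ((x(m) + i g)/p)`; since `#G_p = p − 1`, the image of `i` is exactly the complement of
`k₀` (Darmon: "`Gal(H_{nℓ}/H_n)` permutes `C_1, …, C_{ℓ−1}` simply transitively").
[cite: Darmon2004, Prop. 3.10 (proof, pp. 35–36)] [cite: GrossLMS1991, §3 Prop. 3.7 (proof)] -/
theorem exists_heckeOrbitIndex_of_split (hK : IsImaginaryQuadratic K) (ι : K →+* ℂ) {N : ℕ}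
    [NeZero N] {β : ℤ} (hβ : (4 * N : ℤ) ∣ β ^ 2 - NumberField.discr K) {p m : ℕ} (hp : p.Prime)
    (hp3 : 3 ≤ p) (hpN : p ∣ N) (hsplit : ((Ideal.span {(p : ℤ)}).primesOver (𝓞 K)).ncard = 2)
    (hpm : ¬ p ∣ m) (hm : m ≠ 0) (hunits : 2 ≤ m ∨ NumberField.discr K < -4) [NeZero p] {k₀ : Fin p}
    (hk₀ : kleinJ (tpB p ((k₀ : ℕ) : ℤ) • heegnerPointOfConductor (NumberField.discr K) β m) ∈
      ringClassField K ι m) :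
    ∃ (σ : ringClassGalOver ι (p * m) m → (ℂ ≃+* ℂ))
      (i : ringClassGalOver ι (p * m) m → Fin p),
      Function.Injective i ∧ (∀ g, i g ≠ k₀) ∧
      ∀ g : ringClassGalOver ι (p * m) m,
        (∀ x ∈ ringClassField K ι m, σ g x = x) ∧
        (∀ x : ringClassField K ι (p * m),
          σ g x = (((g : ringClassField K ι (p * m) ≃ₐ[ℚ] ringClassField K ι (p * m)) x :
            ringClassField K ι (p * m)) : ℂ)) ∧
        LevelTransport N (σ g) (heegnerPointOfConductor (NumberField.discr K) β (p * m))
          (tpB p (((i g : Fin p) : ℕ) : ℤ) • heegnerPointOfConductor (NumberField.discr K) β m) := by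
  have hn : p * m ≠ 0 := mul_ne_zero hp.ne_zero hm
  have hmn : m ∣ p * m := dvd_mul_left m p
  have hnot := kleinJ_heegnerPointOfConductor_mul_not_mem_ringClassField_of_split hK ι hβ hp hp3 hsplit hpm
    hm hunits
  have hjD := kleinJ_tpD_smul_mem_ringClassField_of_dvd_level hK ι hβ hp hpN hsplit hpm hm
  -- extensions `σ_g ∈ Aut(ℂ/K[m])`
  have hext : ∀ g : ringClassGalOver ι (p * m) m, ∃ σ : ℂ ≃+* ℂ,
      (∀ x ∈ ringClassField K ι m, σ x = x) ∧
        ∀ x : ringClassField K ι (p * m),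
          σ x = (((g : ringClassField K ι (p * m) ≃ₐ[ℚ] ringClassField K ι (p * m)) x :
            ringClassField K ι (p * m)) : ℂ) :=
    fun g => exists_ringEquiv_extends_of_mem_ringClassGalOver' hK ι hmn hn g.2
  choose σ hσm hσn using hext
  have hσK : ∀ (g : ringClassGalOver ι (p * m) m) (k : K), σ g (ι k) = ι k :=
    fun g => apply_eq_of_forall_mem_ringClassField ι (hσm g)
  -- `σ_g` carries `x(pm)` to some `(x(m) + i g)/p`
  have hidx : ∀ g : ringClassGalOver ι (p * m) m, ∃ j : Fin p,
      LevelTransport N (σ g) (heegnerPointOfConductor (NumberField.discr K) β (p * m))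
        (tpB p ((j : ℕ) : ℤ) • heegnerPointOfConductor (NumberField.discr K) β m) :=
    fun g => exists_levelTransport_tpB_of_fix_ringClassField_of_kleinJ hK ι hβ hp hm (hσm g) hnot hjD
  choose i hi using hidx
  refine ⟨σ, i, ?_, fun g h => ?_, fun g => ⟨hσm g, hσn g, hi g⟩⟩
  · intro g g' hgg'
    have h2 : ((1 : Gamma0 N) : SL(2, ℤ)) •
        (tpB p (((i g : Fin p) : ℕ) : ℤ) • heegnerPointOfConductor (NumberField.discr K) β m) =
        tpB p (((i g' : Fin p) : ℕ) : ℤ) • heegnerPointOfConductor (NumberField.discr K) β m := by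
      rw [hgg', Subgroup.coe_one, one_smul]
    have heq : Set.EqOn (σ g) (σ g') (ringClassField K ι (p * m)) :=
      eqOn_ringClassField_of_levelTransport_of_gamma0_smul_eq hK ι hβ hn (hσK g) (hσK g')
        (hi g) (hi g') h2
    apply Subtype.ext
    ext x
    have hx := heq x.2
    rw [hσn g x, hσn g' x] at hx
    exact_mod_cast hx
  · -- the conjugates avoid the old point: its `j` lies in `K[m]`, `σ_g(j(x(pm)))` does not
    apply hnot
    have hj : σ g (kleinJ (heegnerPointOfConductor (NumberField.discr K) β (p * m))) =
        kleinJ (tpB p ((k₀ : ℕ) : ℤ) • heegnerPointOfConductor (NumberField.discr K) β m) := by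
      rw [← (hi g).kleinJ_eq, h]
    have h' : σ g (kleinJ (heegnerPointOfConductor (NumberField.discr K) β (p * m))) =
        σ g (kleinJ (tpB p ((k₀ : ℕ) : ℤ) • heegnerPointOfConductor (NumberField.discr K) β m)) := by
      rw [hj, hσm g _ hk₀]
    rw [(σ g).injective h']
    exact hk₀

/-! ## §4 The relation in `E(ℂ)` at a split prime `p ∣ N`, `p ∤ m` -/

/-- **`Tr_{K[pm]/K[m]} y(pm) = a_p · y(m) − y'(m)` at a split prime `p ∣ N`, `p ∤ m`, `p ≥ 3`, in `E(ℂ)`**: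
for `K` imaginary quadratic, `4N ∣ β² − d_K`, `m ≥ 1` with `m ≥ 2 ∨ d_K < −4`, any finset `G` enumerating
`Gal(K[pm]/K[m])` and any `y ∈ E(K[pm])` over `y(pm)`, there is a level-`N` Heegner form `Q'` of conductor `m`
(discriminant `m²d_K`, residue `mβ`) with `(∑_{g ∈ G} g • y)_ℂ = a_p(W) • y(m)_ℂ − φ(τ_{Q'})`. (The `p` points
of `U_p(x(m))` are the `p − 1` conjugates of `x(pm)` and the old point `τ_{Q'}`; `U_p f = a_p f`.)
[cite: Darmon2004, Prop. 3.10 (split case; proof p. 36, (3.10)–(3.11))] [cite: Knapp1993, Thm. 11.74 (b)]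
[cite: CornutVatsal2007, §6.2 Lemma 6.5] -/
theorem exists_map_sum_pointGalHom_eq_lFunction_smul_sub (hK : IsImaginaryQuadratic K) (ι : K →+* ℂ)
    {N : ℕ} [NeZero N] {W : WeierstrassCurve ℚ} (Dt : ModularParametrizationData W N) {β : ℤ}
    (hβ : (4 * N : ℤ) ∣ β ^ 2 - NumberField.discr K) {p m : ℕ} (hp : p.Prime) (hp3 : 3 ≤ p)
    (hpN : p ∣ N) (hsplit : ((Ideal.span {(p : ℤ)}).primesOver (𝓞 K)).ncard = 2) (hpm : ¬ p ∣ m)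
    (hm : m ≠ 0) (hunits : 2 ≤ m ∨ NumberField.discr K < -4)
    {G : Finset (ringClassField K ι (p * m) ≃ₐ[ℚ] ringClassField K ι (p * m))}
    (hG : ∀ g, g ∈ G ↔ g ∈ ringClassGalOver ι (p * m) m)
    {y : (W.baseChange (ringClassField K ι (p * m))).toAffine.Point}
    (hy : WeierstrassCurve.Affine.Point.map (W' := W)
        (ringClassField K ι (p * m)).subtype.toRatAlgHom y =
      heegnerPointComplexOfConductor Dt (NumberField.discr K) β (p * m)) :
    ∃ Q' : ℤ × ℤ × ℤ, Q' ∈ heegnerForms N ((m : ℤ) ^ 2 * NumberField.discr K) ∧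
      Q'.2.1 ≡ (m : ℤ) * β [ZMOD 2 * N] ∧
      WeierstrassCurve.Affine.Point.map (W' := W) (ringClassField K ι (p * m)).subtype.toRatAlgHom
          (∑ g ∈ G, pointGalHom W (ringClassField K ι (p * m)) g y) =
        W.LFunction p • heegnerPointComplexOfConductor Dt (NumberField.discr K) β m - Dt.φ (heegnerTau Q') := by
  haveI : NeZero p := ⟨hp.ne_zero⟩
  obtain ⟨k₀, Q', hQ', hQ'β, hk₀⟩ := exists_old_index hK hβ hp hpN hsplit hpm hm
  have hjk₀ : kleinJ (tpB p ((k₀ : ℕ) : ℤ) • heegnerPointOfConductor (NumberField.discr K) β m) ∈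
      ringClassField K ι m := by
    rw [hk₀]; exact kleinJ_mem_ringClassField_of_mem_heegnerForms hK ι hm hQ'
  obtain ⟨σ, i, hinj, hik₀, hσ⟩ :=
    exists_heckeOrbitIndex_of_split hK ι hβ hp hp3 hpN hsplit hpm hm hunits hjk₀
  refine ⟨Q', hQ', hQ'β, ?_⟩
  -- the `p` points of `U_p(x(m))`, indexed by `Fin p`
  let F : Fin p → (W.baseChange ℂ).toAffine.Point := fun j =>
    Dt.φ (tpB p ((j : ℕ) : ℤ) • heegnerPointOfConductor (NumberField.discr K) β m)
  have hterm : ∀ g (hg : g ∈ G),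
      WeierstrassCurve.Affine.Point.map (W' := W) (ringClassField K ι (p * m)).subtype.toRatAlgHom
          (pointGalHom W (ringClassField K ι (p * m)) g y) = F (i ⟨g, (hG g).1 hg⟩) := by
    intro g hg
    obtain ⟨-, hext, hT⟩ := hσ ⟨g, (hG g).1 hg⟩
    rw [map_subtype_pointGalHom_eq ι g hext y, hy, heegnerPointComplexOfConductor]
    exact map_φ_of_levelTransport Dt hT
  -- Eichler–Shimura at `p ∣ N`: `a_p • φ(τ) = Σ_{j<p} φ((τ+j)/p) = Σ_{j ≠ k₀} + φ(τ_{Q'})`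
  have hsum : ∑ j ∈ Finset.univ.erase k₀, F j =
      W.LFunction p • heegnerPointComplexOfConductor Dt (NumberField.discr K) β m - Dt.φ (heegnerTau Q') := by
    rw [eq_sub_iff_add_eq, heegnerPointComplexOfConductor, Dt.lFunction_zsmul_φ p hp, if_pos hpN, add_zero,
      ← hk₀]
    exact Finset.sum_erase_add _ _ (Finset.mem_univ k₀)
  -- the image of `i` is exactly the complement of `k₀` (`#G_p = p − 1`)
  have hcard : Nat.card (ringClassGalOver ι (p * m) m) = p - 1 :=
    card_ringClassGalOver_eq_of_split hK ι hp hsplit hpm hm hunits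
  haveI : Finite (ringClassGalOver ι (p * m) m) :=
    Nat.finite_of_card_ne_zero (by rw [hcard]; omega)
  haveI : Fintype (ringClassGalOver ι (p * m) m) := Fintype.ofFinite _
  have hsurj : ∀ b ∈ Finset.univ.erase k₀, ∃ g : ringClassGalOver ι (p * m) m, i g = b := by
    intro b hb
    by_contra hne
    push Not at hne
    -- `i` maps injectively into `(univ.erase k₀).erase b`, of size `p − 2 < p − 1`
    have hmaps : ∀ g, i g ∈ (Finset.univ.erase k₀).erase b := fun g =>
      Finset.mem_erase.mpr ⟨hne g, Finset.mem_erase.mpr ⟨hik₀ g, Finset.mem_univ _⟩⟩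
    have hle : Fintype.card (ringClassGalOver ι (p * m) m) ≤ ((Finset.univ.erase k₀).erase b).card :=
      Finset.card_le_card_of_injOn i (fun g _ => hmaps g) (fun g₁ _ g₂ _ h => hinj h)
    rw [Finset.card_erase_of_mem hb, Finset.card_erase_of_mem (Finset.mem_univ k₀), Finset.card_univ,
      Fintype.card_fin, ← Nat.card_eq_fintype_card, hcard] at hle
    omega
  rw [map_sum, Finset.sum_bij (t := Finset.univ.erase k₀) (g := F) (fun g hg => i ⟨g, (hG g).1 hg⟩)
    (fun g hg => Finset.mem_erase.mpr ⟨hik₀ _, Finset.mem_univ _⟩)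
    (fun a₁ ha₁ a₂ ha₂ h => congrArg Subtype.val (hinj h))
    (fun b hb => by
      obtain ⟨⟨a, ha⟩, rfl⟩ := hsurj b hb
      exact ⟨a, (hG a).2 ha, rfl⟩)
    hterm, hsum]

/-- The same with the level written `n = p * m`. [cite: Darmon2004, Prop. 3.10 (split case)] -/
theorem exists_map_sum_pointGalHom_eq_lFunction_smul_sub_of_eq (hK : IsImaginaryQuadratic K) (ι : K →+* ℂ)
    {N : ℕ} [NeZero N] {W : WeierstrassCurve ℚ} (Dt : ModularParametrizationData W N) {β : ℤ}
    (hβ : (4 * N : ℤ) ∣ β ^ 2 - NumberField.discr K) {p m n : ℕ} (hp : p.Prime) (hp3 : 3 ≤ p)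
    (hpN : p ∣ N) (hsplit : ((Ideal.span {(p : ℤ)}).primesOver (𝓞 K)).ncard = 2) (hpm : ¬ p ∣ m)
    (hm : m ≠ 0) (hunits : 2 ≤ m ∨ NumberField.discr K < -4) (hn : p * m = n)
    {G : Finset (ringClassField K ι n ≃ₐ[ℚ] ringClassField K ι n)}
    (hG : ∀ g, g ∈ G ↔ g ∈ ringClassGalOver ι n m)
    {y : (W.baseChange (ringClassField K ι n)).toAffine.Point}
    (hy : WeierstrassCurve.Affine.Point.map (W' := W)
        (ringClassField K ι n).subtype.toRatAlgHom y =
      heegnerPointComplexOfConductor Dt (NumberField.discr K) β n) :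
    ∃ Q' : ℤ × ℤ × ℤ, Q' ∈ heegnerForms N ((m : ℤ) ^ 2 * NumberField.discr K) ∧
      Q'.2.1 ≡ (m : ℤ) * β [ZMOD 2 * N] ∧
      WeierstrassCurve.Affine.Point.map (W' := W) (ringClassField K ι n).subtype.toRatAlgHom
          (∑ g ∈ G, pointGalHom W (ringClassField K ι n) g y) =
        W.LFunction p • heegnerPointComplexOfConductor Dt (NumberField.discr K) β m - Dt.φ (heegnerTau Q') := by
  subst hn
  exact exists_map_sum_pointGalHom_eq_lFunction_smul_sub hK ι Dt hβ hp hp3 hpN hsplit hpm hm hunits hG hy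

/-! ## §5 In `E(K̄)`: conductor `p` over conductor `1` at `p ∣ N` -/

/-- **`Norm_{K[p]/K[1]} x_p = a_p • x₁ − x'` IN `E(K̄)` at a split prime `p ∣ N`, `p ≥ 3`, `d_K < −4`**, over ANY
finite transversal `R` of `Gal(K̄/K[p])` in `Gal(K̄/K[1])`: for `x₁, x_p ∈ E(K̄)` over the canonical points
`y(1)`, `y(p)` (`x_p` read over `K[p]`), `∑_{r ∈ R} r • x_p = a_p(W) • x₁ − x'` with `x'` a Heegner point of
conductor `1` and orientation `β` (`IsHeegnerGeomPoint N W K Dt β 1 jbar x'`; the OLD point of `U_p(x(1))`).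
§4 read in `E(K̄)` (`exists_finset_ringClassGalOver_complexPoint_sum_smul_eq`, `complexPoint_injective`,
`HeegnerGeomBottomRelationProofs.exists_geomPoint_of_mem_heegnerForms`).
[cite: Darmon2004, Prop. 3.10 (split case; proof p. 36)] [cite: PerrinRiou1987BSMF, §3.3] -/
theorem exists_sum_transversal_smul_eq_lFunction_smul_sub {N : ℕ} [NeZero N] {W : WeierstrassCurve ℚ}
    [W.IsElliptic] (hK : IsImaginaryQuadratic K) (Dt : ModularParametrizationData W N) {β : ℤ}
    (hβ : (4 * N : ℤ) ∣ β ^ 2 - NumberField.discr K) (jbar : AlgebraicClosure K →+* ℂ) {p : ℕ}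
    (hp : p.Prime) (hp3 : 3 ≤ p) (hpN : p ∣ N) (hsplit : ((Ideal.span {(p : ℤ)}).primesOver (𝓞 K)).ncard = 2)
    (hd4 : NumberField.discr K < -4) {x₁ xp : WeierstrassCurve.geomPoints (W.baseChange K)}
    (hx₁ : complexPoint W jbar x₁ = heegnerPointComplexOfConductor Dt (NumberField.discr K) β 1)
    {P : (W.baseChange (ringClassField K (jbar.comp (algebraMap K (AlgebraicClosure K))) p)).toAffine.Point}
    (hxp : complexPoint W jbar xp = WeierstrassCurve.Affine.Point.map (W' := W)
      (ringClassField K (jbar.comp (algebraMap K (AlgebraicClosure K))) p).subtype.toRatAlgHom P)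
    (hP : WeierstrassCurve.Affine.Point.map (W' := W)
      (ringClassField K (jbar.comp (algebraMap K (AlgebraicClosure K))) p).subtype.toRatAlgHom P =
      heegnerPointComplexOfConductor Dt (NumberField.discr K) β p)
    {R : Finset (Field.absoluteGaloisGroup K)} (hRsub : ∀ r ∈ R, r ∈ ringClassSubgroup K 1 jbar)
    (htrans : ∀ τ ∈ ringClassSubgroup K 1 jbar, ∃! r, r ∈ R ∧ r⁻¹ * τ ∈ ringClassSubgroup K p jbar) :
    ∃ x' : WeierstrassCurve.geomPoints (W.baseChange K), IsHeegnerGeomPoint N W K Dt β 1 jbar x' ∧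
      ∑ r ∈ R, r • xp = (W.LFunction p) • x₁ - x' := by
  haveI : NeZero p := ⟨hp.ne_zero⟩
  set ι : K →+* ℂ := jbar.comp (algebraMap K (AlgebraicClosure K)) with hι
  have hp0 : p ≠ 0 := hp.ne_zero
  -- the transversal sum is the Galois trace in `E(K[p])`
  obtain ⟨G, hG, hsum⟩ := exists_finset_ringClassGalOver_complexPoint_sum_smul_eq W hK jbar one_ne_zero hp0
    (one_dvd p) hxp hRsub htrans
  -- the split relation at `m = 1`
  obtain ⟨Q', hQ', hQ'β, key⟩ := exists_map_sum_pointGalHom_eq_lFunction_smul_sub_of_eq hK ι Dt hβ hp hp3 hpN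
    hsplit (fun h => hp.one_lt.ne' (Nat.dvd_one.mp h)) one_ne_zero (Or.inr hd4) (mul_one p) hG hP
  have hQ'' : Q' ∈ heegnerForms N (NumberField.discr K) := by simpa using hQ'
  obtain ⟨x', hx', -⟩ := exists_geomPoint_of_mem_heegnerForms hK Dt jbar hQ''
  refine ⟨x', ⟨Q', by simpa using hQ', by simpa using hQ'β, hx'⟩, ?_⟩
  apply complexPoint_injective W jbar
  rw [hsum, key, map_sub, map_zsmul, hx₁, hx', heegnerPointComplexOfConductor]

/-! ## §6 The bottom of the canonical family at `p ∣ N`: `z_0 = a_p • y − y` -/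

section Family

variable {p : ℕ} [Fact p.Prime] {N : ℕ} [NeZero N] {W : WeierstrassCurve ℚ} [W.IsElliptic]
  {κ : ZpExtension K p} {jbar : AlgebraicClosure K →+* ℂ}

/-- **`z_0 = a_p(W) • y − y` for the canonical Heegner family at a prime `p ∣ N`** (`p ≥ 3`; `K` imaginary
quadratic with the Heegner hypothesis for `N` — so `p` splits — and `d_K < −4`). Let `F` be a Heegner family
whose bottom points are the canonical ones: `y = ∑_{a ∈ R₀} a • x₁` (`x₁` over `y(1)`, fixed by
`Gal(K̄/K[1])`, `R₀` a transversal of `Gal(K̄/K[1])` in `Γ_K`) and `z_0 = ∑_{r ∈ R} r • x_p` (`x_p` over `y(p)`,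
`R ⊆ Gal(K̄/K_0) = Γ_K` a transversal of `Gal(K̄/K[p])`) — the data of `exists_heegnerFamily_canonical`. Then
`z_0 = a_p • y − y`: decompose `R` through `Gal(K̄/K[1])` (`sum_smul_eq_sum_sum_smul`), apply §5, and
`Norm_{K[1]/K} x' = Norm_{K[1]/K} x₁` for the two conductor-`1` Heegner points `x', x₁` of orientation `β`
(Shimura reciprocity, `HeegnerGeomBottomRelationProofs.sum_smul_eq_sum_smul_of_isHeegnerGeomPoint_one`). No tower
hypothesis (`K_0 = K`). [cite: GrossLMS1991, §1 (y_K = Tr_{K_1/K} y_1) and §3 Prop. 3.7]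
[cite: Darmon2004, Prop. 3.10 and Thm. 3.7] [cite: PerrinRiou1987BSMF, §3.3] -/
theorem z_zero_eq_lFunction_smul_y_sub_y (hK : IsImaginaryQuadratic K) (hH : SatisfiesHeegnerHypothesis N K)
    (hd4 : NumberField.discr K < -4) (hp3 : 3 ≤ p) (hpN : p ∣ N) (F : HeegnerFamily N W K κ jbar)
    {x₁ : WeierstrassCurve.geomPoints (W.baseChange K)} {R₀ : Finset (Field.absoluteGaloisGroup K)}
    (hx₁ : complexPoint W jbar x₁ = heegnerPointComplexOfConductor F.Dt (NumberField.discr K) F.β 1)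
    (hfix₁ : ∀ σ ∈ ringClassSubgroup K 1 jbar, σ • x₁ = x₁)
    (htrans₀ : ∀ τ : Field.absoluteGaloisGroup K, ∃! r, r ∈ R₀ ∧ r⁻¹ * τ ∈ ringClassSubgroup K 1 jbar)
    (hy : F.y = ∑ r ∈ R₀, r • x₁)
    {xp : WeierstrassCurve.geomPoints (W.baseChange K)} {R : Finset (Field.absoluteGaloisGroup K)}
    (hxp : complexPoint W jbar xp = heegnerPointComplexOfConductor F.Dt (NumberField.discr K) F.β (p ^ (0 + 1)))
    (hfixp : ∀ σ ∈ ringClassSubgroup K (p ^ (0 + 1)) jbar, σ • xp = xp)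
    (hRsub : ↑R ⊆ (κ.layerSubgroup 0 : Set (Field.absoluteGaloisGroup K)))
    (htrans : ∀ τ ∈ κ.layerSubgroup 0, ∃! r, r ∈ R ∧ r⁻¹ * τ ∈ ringClassSubgroup K (p ^ (0 + 1)) jbar)
    (hz : F.z 0 = ∑ r ∈ R, r • xp) :
    F.z 0 = (W.LFunction p) • F.y - F.y := by
  have hp : p.Prime := Fact.out
  have hp1 : p ^ (0 + 1) = p := by rw [zero_add, pow_one]
  rw [hp1] at hxp hfixp htrans
  set ι : K →+* ℂ := jbar.comp (algebraMap K (AlgebraicClosure K)) with hι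
  have hsplit := hH p hp hpN
  -- `x_p` read over `K[p]`
  obtain ⟨P, hP⟩ := phi_heegnerPointOfConductor_mem_range_map_ringClassField_of_ne_zero N W K hK F.Dt F.β ι p
    F.dvd_sq_sub hp.ne_zero
  have hxpP : complexPoint W jbar xp = WeierstrassCurve.Affine.Point.map (W' := W)
      (ringClassField K ι p).subtype.toRatAlgHom P := hxp.trans hP.symm
  -- a transversal `V` of `Gal(K̄/K[p])` in `Gal(K̄/K[1])`
  haveI : (ringClassSubgroup K p jbar).FiniteIndex := finiteIndex_ringClassSubgroup K p jbar
  obtain ⟨V, hV, htV⟩ := exists_finset_transversal' (ringClassSubgroup K p jbar) (ringClassSubgroup K 1 jbar)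
  have hle : ringClassSubgroup K p jbar ≤ ringClassSubgroup K 1 jbar :=
    ringClassSubgroup_anti hK jbar (one_dvd p) hp.ne_zero
  have hle₀ : ringClassSubgroup K 1 jbar ≤ κ.layerSubgroup 0 := by rw [ZpExtension.layerSubgroup_zero]; exact le_top
  have hR₀ : ∀ a ∈ R₀, a ∈ κ.layerSubgroup 0 := fun a _ ↦ by
    rw [ZpExtension.layerSubgroup_zero]; exact Subgroup.mem_top a
  -- §5 on the inner sum, Shimura reciprocity on the old point
  obtain ⟨x', hx'H, hinner⟩ := exists_sum_transversal_smul_eq_lFunction_smul_sub hK F.Dt F.dvd_sq_sub jbar hp hp3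
    hpN hsplit hd4 hx₁ hxpP hP hV htV
  have hx₁H : IsHeegnerGeomPoint N W K F.Dt F.β 1 jbar x₁ := by
    obtain ⟨hQ, hQβ⟩ := heegnerFormOfConductor_mem_heegnerForms (N := N) hK.discr_neg F.dvd_sq_sub one_ne_zero
    refine ⟨heegnerFormOfConductor (NumberField.discr K) F.β 1, by simpa [mul_comm] using hQ, by simpa using hQβ, ?_⟩
    rw [hx₁]
    rfl
  rw [hz, hy, sum_smul_eq_sum_sum_smul hle hle₀ hR₀ (fun τ _ ↦ htrans₀ τ) hV htV
    (fun r hr ↦ hRsub (Finset.mem_coe.mpr hr)) htrans hfixp]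
  simp_rw [hinner, smul_sub, Finset.sum_sub_distrib, smul_comm _ (W.LFunction p), ← Finset.smul_sum]
  rw [sum_smul_eq_sum_smul_of_isHeegnerGeomPoint_one hK hH F.Dt jbar F.dvd_sq_sub hx₁H hx'H hfix₁ htrans₀]

/-- **The canonical family at `p ∣ N` has `z_0 = a_p(W) • y − y`**, packaged with
`exists_heegnerFamily_canonical`: for `K` imaginary quadratic with the Heegner hypothesis for `N` and `d_K < −4`,
a prime `p ≥ 3` dividing `N`, any `ℤ_p`-extension `κ`, datum `Dt`, orientation `β`, embedding `jbar`, there is a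
Heegner family `F` (the canonical one) with `F.Dt = Dt`, `F.β = β` and `F.z 0 = a_p(W) • F.y − F.y`.
[cite: GrossLMS1991, §1 and §3 Prop. 3.7] [cite: Darmon2004, Prop. 3.10 and Thm. 3.7] -/
theorem exists_heegnerFamily_z_zero_eq (hK : IsImaginaryQuadratic K) (hH : SatisfiesHeegnerHypothesis N K)
    (hd4 : NumberField.discr K < -4) (hp3 : 3 ≤ p) (hpN : p ∣ N) (κ : ZpExtension K p)
    (Dt : ModularParametrizationData W N) {β : ℤ} (hβ : (4 * N : ℤ) ∣ β ^ 2 - NumberField.discr K)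
    (jbar : AlgebraicClosure K →+* ℂ) :
    ∃ F : HeegnerFamily N W K κ jbar, F.Dt = Dt ∧ F.β = β ∧ F.z 0 = (W.LFunction p) • F.y - F.y := by
  obtain ⟨F, hFDt, hFβ, ⟨x₁, R₀, hx₁, hfix₁, htrans₀, hy⟩, hcan⟩ := exists_heegnerFamily_canonical hK κ Dt hβ jbar
  obtain ⟨xp, R, hxp, hfixp, hRsub, htrans, hz⟩ := hcan 0
  subst hFDt hFβ
  exact ⟨F, rfl, rfl, z_zero_eq_lFunction_smul_y_sub_y hK hH hd4 hp3 hpN F hx₁ hfix₁ htrans₀ hy hxp hfixp hRsub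
    htrans hz⟩

/-- **At a prime `p ∣ N` with `a_p(W) = 0` (additive `p`) the canonical family has `z_0 = −y`**: the bottom norm
point `Norm_{K[p]/K} P[p]` IS `−y_K`, so it is non-torsion exactly when the basic Heegner point `y_K` is
(Gross–Zagier), with no appeal to Cornut–Vatsal non-triviality at the bottom layer. Setting as in
`exists_heegnerFamily_z_zero_eq`. [cite: GrossLMS1991, §1 (y_K) and §3] [cite: CornutVatsal2007, §1.3 (good CM points of conductor P)] -/
theorem exists_heegnerFamily_z_zero_eq_neg (hK : IsImaginaryQuadratic K) (hH : SatisfiesHeegnerHypothesis N K)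
    (hd4 : NumberField.discr K < -4) (hp3 : 3 ≤ p) (hpN : p ∣ N) (hap : W.LFunction p = 0)
    (κ : ZpExtension K p) (Dt : ModularParametrizationData W N) {β : ℤ}
    (hβ : (4 * N : ℤ) ∣ β ^ 2 - NumberField.discr K) (jbar : AlgebraicClosure K →+* ℂ) :
    ∃ F : HeegnerFamily N W K κ jbar, F.Dt = Dt ∧ F.β = β ∧ F.z 0 = -F.y ∧
      (¬ IsOfFinAddOrder F.y → ¬ IsOfFinAddOrder (F.z 0)) := by
  obtain ⟨F, hFDt, hFβ, hz⟩ := exists_heegnerFamily_z_zero_eq hK hH hd4 hp3 hpN κ Dt hβ jbar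
  rw [hap, zero_zsmul, zero_sub] at hz
  refine ⟨F, hFDt, hFβ, hz, fun hy hz0 ↦ hy ?_⟩
  rw [hz] at hz0
  simpa using hz0.neg

end Family

end HeegnerTraceLevelDividingSplit

end Literature.NumberTheory.EllipticCurves

end
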